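import Literature.MathematicalPhysics.KineticTheory.CollisionTubeGeometry
import HarnessLib

/-!
# The static collision tube: the flight time is the FIRST contact time of the free flight

Topic `Literature/MathematicalPhysics/KineticTheory` (kind proof; pure geometry, companion of
`CollisionTubeGeometry.lean`; the bridge between the two static readings of Boltzmann's collision cylinder
used by the crux lines of `JParityClosure.EvenStressEnskog` (stmt-AtomisticToContinuum-13079: the tube
predicate `flightTime w q ≤ κ` of `tubeStat`) and `JParityClosure.RateFloor` (stmt-AtomisticToContinuum-13080,
line `Sketch`: "the free flights come within `ε` during `(0, Δ]`", first contact time as an infimum)).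

For a point `q = n_h − t_h w` of the strict tube of the relative velocity `w` (`CollisionTubeGeometry.strictTube`,
`strictTube_spec`: `t_h = flightTime w q > 0`, `‖n_h‖ = 1`, `⟪n_h, w⟫ < 0`), along the free flight
`s ↦ q + s w`:

* `norm_add_smul_sq_of_mem_strictTube` — `‖q + s w‖² = 1 − 2 (t_h − s) ⟪n_h, w⟫ + (t_h − s)² ‖w‖²`;
* `one_lt_norm_add_smul_of_lt_flightTime` — the pair is apart (`‖q + s w‖ > 1`) strictly before `t_h`, and
  `norm_add_flightTime_smul` — in contact (`= 1`) at `t_h`;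
* `isLeast_flightTime`, `sInf_eq_flightTime` — hence `t_h` is the LEAST `s ∈ (0, κ]` with `‖q + s w‖ ≤ 1`:
  the flight time of the tube predicate is the first contact time of the free flight;
* at diameter `ε > 0` (`ε⁻¹ q` in the strict unit tube): `isLeast_mul_flightTime`, `sInf_eq_mul_flightTime` —
  `ε t_h(ε⁻¹ q)` is the least `u ∈ (0, κ ε]` with `‖q + u w‖ ≤ ε`; `add_mul_flightTime_smul` — the separation
  there is `ε n_h(ε⁻¹ q)`, of norm `ε` (`norm_add_mul_flightTime_smul`); `norm_le_of_smul_mem_strictTube` — such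
  `q` lies in the shell `ε < ‖q‖ ≤ ε (1 + κ‖w‖)`.

References: C. Cercignani, R. Illner, M. Pulvirenti, *The Mathematical Theory of Dilute Gases* (1994), §2.2 and
App. 4.A [CIPDiluteGases1994]; I. Gallagher, L. Saint-Raymond, B. Texier, *From Newton to Boltzmann* (2013),
§4.1, §4.3 [GallagherSaintRaymondTexier2013].
-/

noncomputable section

open Set
open scoped InnerProductSpace

namespace Literature.MathematicalPhysics.KineticTheory

variable {E : Type*} [NormedAddCommGroup E] [InnerProductSpace ℝ E]

/-! ## Unit diameter -/

section Unit

variable {κ : ℝ} {w q : E}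

/-- **The squared distance along the flight of a strict-tube point**:
`‖q + s w‖² = 1 − 2 (t_h − s) ⟪n_h, w⟫ + (t_h − s)² ‖w‖²` (`q = n_h − t_h w`, `‖n_h‖ = 1`).
[cite: CIPDiluteGases1994, App. 4.A] -/
theorem norm_add_smul_sq_of_mem_strictTube (hq : q ∈ strictTube κ w) (s : ℝ) :
    ‖q + s • w‖ ^ 2 = 1 - 2 * (flightTime w q - s) * ⟪impactNormal w q, w⟫_ℝ +
      (flightTime w q - s) ^ 2 * ‖w‖ ^ 2 := by
  obtain ⟨-, hn1, -, hq'⟩ := strictTube_spec hq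
  have e : q + s • w = impactNormal w q - (flightTime w q - s) • w := by
    conv_lhs => rw [hq']
    rw [sub_smul]
    abel
  rw [e, norm_sub_smul_sq hn1]

/-- **Strictly before the flight time the pair is apart**: `1 < ‖q + s w‖` for `s < t_h`.
[cite: CIPDiluteGases1994, §2.2] -/
theorem one_lt_norm_add_smul_of_lt_flightTime (hq : q ∈ strictTube κ w) {s : ℝ} (hs : s < flightTime w q) :
    1 < ‖q + s • w‖ := by
  obtain ⟨-, -, hnw, -⟩ := strictTube_spec hq
  have h2 : 1 < ‖q + s • w‖ ^ 2 := by
    rw [norm_add_smul_sq_of_mem_strictTube hq s]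
    have h3 : 0 < (flightTime w q - s) * (-⟪impactNormal w q, w⟫_ℝ) := mul_pos (by linarith) (by linarith)
    nlinarith [sq_nonneg (flightTime w q - s), sq_nonneg ‖w‖, mul_nonneg (sq_nonneg (flightTime w q - s)) (sq_nonneg ‖w‖)]
  exact lt_of_pow_lt_pow_left₀ 2 (norm_nonneg _) (by rwa [one_pow])

/-- **At the flight time the pair is in contact**: `‖q + t_h w‖ = 1`. [cite: CIPDiluteGases1994, §2.2] -/
theorem norm_add_flightTime_smul (hq : q ∈ strictTube κ w) : ‖q + flightTime w q • w‖ = 1 :=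
  (strictTube_spec hq).2.1

/-- **The flight time is the first contact time of the free flight**: `t_h` is the least `s ∈ (0, κ]` with
`‖q + s w‖ ≤ 1`. [cite: CIPDiluteGases1994, §2.2] -/
theorem isLeast_flightTime (hq : q ∈ strictTube κ w) :
    IsLeast {s : ℝ | s ∈ Ioc 0 κ ∧ ‖q + s • w‖ ≤ 1} (flightTime w q) := by
  refine ⟨⟨⟨(strictTube_spec hq).1, hq.2.2.2⟩, (norm_add_flightTime_smul hq).le⟩, fun s hs => ?_⟩
  by_contra hlt
  push Not at hlt
  exact (one_lt_norm_add_smul_of_lt_flightTime hq hlt).not_ge hs.2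

/-- The infimum form: `inf {s ∈ (0, κ] | ‖q + s w‖ ≤ 1} = t_h`. [cite: CIPDiluteGases1994, §2.2] -/
theorem sInf_eq_flightTime (hq : q ∈ strictTube κ w) :
    sInf {s : ℝ | s ∈ Ioc 0 κ ∧ ‖q + s • w‖ ≤ 1} = flightTime w q :=
  (isLeast_flightTime hq).csInf_eq

end Unit

/-! ## Diameter `ε` -/

section Scale

variable {κ ε : ℝ} {w q : E}

/-- Rescaling the flight: `ε⁻¹ (q + u w) = ε⁻¹ q + (ε⁻¹ u) w`. [folklore] -/
theorem inv_smul_add_smul (ε : ℝ) (q w : E) (u : ℝ) : ε⁻¹ • (q + u • w) = ε⁻¹ • q + (ε⁻¹ * u) • w := by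
  rw [smul_add, smul_smul]

/-- `‖q + u w‖ ≤ ε ↔ ‖ε⁻¹ q + (ε⁻¹ u) w‖ ≤ 1` (`ε > 0`). [folklore] -/
theorem norm_add_smul_le_iff (hε : 0 < ε) (q w : E) (u : ℝ) :
    ‖q + u • w‖ ≤ ε ↔ ‖ε⁻¹ • q + (ε⁻¹ * u) • w‖ ≤ 1 := by
  rw [← inv_smul_add_smul, norm_smul, Real.norm_eq_abs, abs_of_pos (inv_pos.2 hε), inv_mul_le_iff₀ hε, mul_one]

/-- **At diameter `ε`: `ε t_h(ε⁻¹ q)` is the least `u ∈ (0, κ ε]` with `‖q + u w‖ ≤ ε`** (the first time the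
free flight of a pair at rescaled separation in the strict unit tube comes within `ε`). [cite: CIPDiluteGases1994, §2.2] -/
theorem isLeast_mul_flightTime (hε : 0 < ε) (hq : ε⁻¹ • q ∈ strictTube κ w) :
    IsLeast {u : ℝ | u ∈ Ioc 0 (κ * ε) ∧ ‖q + u • w‖ ≤ ε} (ε * flightTime w (ε⁻¹ • q)) := by
  have hL := isLeast_flightTime hq
  constructor
  · obtain ⟨⟨h0, hκ⟩, h1⟩ := hL.1
    refine ⟨⟨mul_pos hε h0, ?_⟩, ?_⟩
    · rw [mul_comm]; exact mul_le_mul_of_nonneg_right hκ hε.le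
    · rw [norm_add_smul_le_iff hε, ← mul_assoc, inv_mul_cancel₀ hε.ne', one_mul]; exact h1
  · intro u hu
    have hu' : ε⁻¹ * u ∈ {s : ℝ | s ∈ Ioc 0 κ ∧ ‖ε⁻¹ • q + s • w‖ ≤ 1} := by
      refine ⟨⟨mul_pos (inv_pos.2 hε) hu.1.1, ?_⟩, (norm_add_smul_le_iff hε q w u).1 hu.2⟩
      rw [inv_mul_le_iff₀ hε, mul_comm]; exact hu.1.2
    have h := hL.2 hu'
    rwa [le_inv_mul_iff₀ hε] at h

/-- The infimum form at diameter `ε`. [cite: CIPDiluteGases1994, §2.2] -/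
theorem sInf_eq_mul_flightTime (hε : 0 < ε) (hq : ε⁻¹ • q ∈ strictTube κ w) :
    sInf {u : ℝ | u ∈ Ioc 0 (κ * ε) ∧ ‖q + u • w‖ ≤ ε} = ε * flightTime w (ε⁻¹ • q) :=
  (isLeast_mul_flightTime hε hq).csInf_eq

/-- **The separation at the first contact time is `ε` times the impact normal**:
`q + ε t_h(ε⁻¹ q) w = ε n_h(ε⁻¹ q)`. [cite: CIPDiluteGases1994, App. 4.A] -/
theorem add_mul_flightTime_smul (hε : 0 < ε) (q w : E) :
    q + (ε * flightTime w (ε⁻¹ • q)) • w = ε • impactNormal w (ε⁻¹ • q) := by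
  rw [impactNormal, smul_add, smul_smul, mul_inv_cancel₀ hε.ne', one_smul, smul_smul]

/-- At the first contact time the pair is exactly at distance `ε`. [cite: CIPDiluteGases1994, §2.2] -/
theorem norm_add_mul_flightTime_smul (hε : 0 < ε) (hq : ε⁻¹ • q ∈ strictTube κ w) :
    ‖q + (ε * flightTime w (ε⁻¹ • q)) • w‖ = ε := by
  rw [add_mul_flightTime_smul hε, norm_smul, Real.norm_eq_abs, abs_of_pos hε, (strictTube_spec hq).2.1, mul_one]

/-- A separation whose rescaling lies in the strict unit tube lies in the shell `ε < ‖q‖ ≤ ε (1 + κ ‖w‖)`.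
[cite: CIPDiluteGases1994, §2.2] -/
theorem norm_le_of_smul_mem_strictTube (hε : 0 < ε) (hq : ε⁻¹ • q ∈ strictTube κ w) :
    ε < ‖q‖ ∧ ‖q‖ ≤ ε * (1 + κ * ‖w‖) := by
  obtain ⟨h1, h2⟩ := strictTube_subset_shell κ w hq
  rw [norm_smul, Real.norm_eq_abs, abs_of_pos (inv_pos.2 hε)] at h1 h2
  rw [lt_inv_mul_iff₀ hε, mul_one] at h1
  rw [inv_mul_le_iff₀ hε] at h2
  exact ⟨h1, h2⟩

end Scale

end Literature.MathematicalPhysics.KineticTheory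

end
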